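import Summits.HodgeConjecture.CorCM.IrreducibleOddWeightsIsotypicExistenceRank
import Summits.HodgeConjecture.CorCM.IrreducibleOddWeightsMultiClassHodgeEquivalence
import HarnessLib

/-!
# Isotypic cells, existence VI: THE REFERENCES ARE A COMPLETE SYSTEM OF REPRESENTATIVES — every irreducible
# constituent of a slot is the isomorphic image of EXACTLY ONE reference; HODGE EQUIVALENCE OF TWO MEMBERS DECIDED
# CLASS BY CLASS WITH NO INPUT BUT THE TYPES

COR-CM (cell `pub-hodgecm2`, binder seat `b16` gen 76, count-neutral claim THE ISOTYPIC DECOMPOSITION EXISTS, file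
E6 — abstract `G`-set level, type vectors and the CM dress; theorems only, no definition, no named fact, no
`sorry`).  NEW as stated, hence under `Summits/`.  HONEST FRAMING: consequences of the CLAUSES of the master theorem
E3 (`exists_isotypic_decomposition`): references `A_c ≤ ℚ^{Y_c}` stable irreducible pairwise non-embeddable,
embeddings `ι_{c,j} : ℚ^{Y_c} → ℚ^{Y₀}` equivariant and injective on `A_c` whose images span `ℚ^{Y₀}`.  Nothing
about Hodge classes is asserted; `HC_CM` is neither used nor asserted.

* §1 `onto_of_embed_of_irreducible'` — cross-pivot form of E1 §2: an equivariant embedding of a non-zero stable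
  `A ≤ ℚ^{Y_A}` into an irreducible `N ≤ ℚ^{Y₀}` is ONTO `N`.
* §2 **COMPLETENESS** (`exists_class_iso_of_irreducible`): every non-zero stable irreducible `N ≤ ℚ^{Y₀}` is the
  image of some reference under an equivariant isomorphism `θ : A_c ≅ N` (`θ = P ∘ ι_{c,j}` for the Jordan–Hölder
  isomorphism `P : ι_{c,j}(A_c) ≅ N` of gen 70 I2, `N` lying in the span of the irreducible images).
* §3 **UNIQUENESS** (`eq_of_embed_of_onto`): if `A_c` maps equivariantly ONTO `N` and `A_{c′}` embeds
  equivariantly INTO `N`, then `c = c′` (gen 75 M1's transport gives `A_{c′} ↪ A_c`, excluded by separation) — so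
  the references are a COMPLETE SYSTEM OF REPRESENTATIVES of the irreducible constituents of every slot.
* §4 **HODGE EQUIVALENCE WITH NO INPUT BUT THE TYPES** (`exists_isotypic_span_coeff_eq_iff`): for ANY sets
  `Φ_i ⊆ E_i` there is an isotypic decomposition of the type vectors for which, for every two members `i₀, i₁`,
  **`MC_{i₁} = MC_{i₀} ⟺ ∀ c, ⨆_j 𝒟_c·b^{i₁}_{c,j} = ⨆_j 𝒟_c·b^{i₀}_{c,j}`** (`MC_i = span{g ↦ u_i(g·x)}`, the
  character space of `MT(A_i)`; gen 75 M8 + E3); two-member families: `exists_isotypic_typeRank_pair_eq_and_eq_iff`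
  (`rank Σ = rank Φ₀ = rank Φ₁ ⟺` the same), CM dress `exists_isotypic_cmFamilyRank_pair_eq_and_eq_iff`
  (`A₀`, `A₁` mutually Hodge-dominated, i.e. `dim MT(A₀ × A₁) = dim MT(A₀) = dim MT(A₁)`, iff class by class the
  D-spans agree).

## References

* [Serre1977] J.-P. Serre, *Linear Representations of Finite Groups*, GTM 42, §2.2 (Schur), §2.6 (canonical
  decomposition: uniqueness of the isotypic components).
* [Lang2002] S. Lang, *Algebra*, 3rd ed., XVII §1 Prop. 1.1, XVII §2.
* [Deligne1982HodgeCycles] P. Deligne, *Hodge cycles on abelian varieties*, LNM 900 (1982), I.3.4, I.5 (p. 53).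
* [Gordon1999HodgeAVSurvey] B. B. Gordon, *A survey of the Hodge conjecture for abelian varieties*, 7.5–7.7, 9.4.3.
-/

set_option autoImplicit false

noncomputable section

open scoped BigOperators Classical

universe u uC uJ v v' vA vC w

namespace Summit.HodgeConjecture.CorCM.IrrOdd

open Literature.NumberTheory.ComplexMultiplication

variable {G : Type w} [Group G]

/-! ### §1 Cross-pivot: an embedding into an irreducible is onto -/

section Abstract

variable {Y₀ : Type v'} [MulAction G Y₀] {YA : Type vA} [MulAction G YA]

/-- **AN EQUIVARIANT EMBEDDING OF A NON-ZERO STABLE `A ≤ ℚ^{Y_A}` INTO AN IRREDUCIBLE `N ≤ ℚ^{Y₀}` IS ONTO `N`**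
(the image `θ(A)` is a non-zero stable subspace of `N`; cross-pivot form of E1's `onto_of_embed_of_irreducible`).
[cite: Serre1977, §2.2] [cite: Lang2002, XVII §1 Prop. 1.1] -/
theorem onto_of_embed_of_irreducible' (θ : (YA → ℚ) →ₗ[ℚ] (Y₀ → ℚ)) {A : Submodule ℚ (YA → ℚ)}
    {N : Submodule ℚ (Y₀ → ℚ)}
    (hAst : ∀ (k : G) (a : YA → ℚ), a ∈ A → (fun y => a (k • y)) ∈ A) (hA0 : A ≠ ⊥)
    (hNirr : ∀ W : Submodule ℚ (Y₀ → ℚ), W ≤ N → W ≠ ⊥ →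
      (∀ (k : G) (f : Y₀ → ℚ), f ∈ W → (fun y => f (k • y)) ∈ W) → W = N)
    (hθN : ∀ a ∈ A, θ a ∈ N) (hθinj : ∀ a ∈ A, θ a = 0 → a = 0)
    (hθeq : ∀ (k : G) (a : YA → ℚ), a ∈ A → θ (fun y => a (k • y)) = fun y => θ a (k • y)) :
    ∀ v ∈ N, ∃ a ∈ A, θ a = v := by
  have himage : A.map θ = N := by
    refine hNirr _ (fun x hx => ?_) ?_ ?_
    · obtain ⟨a, ha, rfl⟩ := Submodule.mem_map.1 hx
      exact hθN a ha
    · intro h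
      apply hA0
      rw [eq_bot_iff]
      intro a ha
      have hθa : θ a ∈ A.map θ := Submodule.mem_map_of_mem ha
      rw [h, Submodule.mem_bot] at hθa
      rw [Submodule.mem_bot]
      exact hθinj a ha hθa
    · intro k x hx
      obtain ⟨a, ha, rfl⟩ := Submodule.mem_map.1 hx
      rw [← hθeq k a ha]
      exact Submodule.mem_map_of_mem (hAst k a ha)
  intro v hv
  rw [← himage] at hv
  obtain ⟨a, ha, rfl⟩ := Submodule.mem_map.1 hv
  exact ⟨a, ha, rfl⟩

/-! ### §2 Completeness: every irreducible constituent is the isomorphic image of a reference -/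

variable [Fintype Y₀] {C : Type uC} [Fintype C] {Yc : C → Type vC} [∀ c, MulAction G (Yc c)]
  [∀ c, Fintype (Yc c)] {Ar : ∀ c, Submodule ℚ (Yc c → ℚ)} {JJ : C → Type uJ} [∀ c, Fintype (JJ c)]

omit [Fintype Y₀] [∀ c, Fintype (Yc c)] in
/-- **COMPLETENESS OF THE REFERENCES.**  `A_c ≤ ℚ^{Y_c}` stable irreducible, `ι_{c,j} : ℚ^{Y_c} → ℚ^{Y₀}`
equivariant and injective on `A_c` with `⨆_{c,j} ι_{c,j}(A_c) = ℚ^{Y₀}`.  Then every NON-ZERO STABLE IRREDUCIBLE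
`N ≤ ℚ^{Y₀}` is the image of some reference under an equivariant ISOMORPHISM: some linear
`θ : ℚ^{Y_c} → ℚ^{Y₀}` maps `A_c` into `N`, injectively, ONTO `N`, equivariantly on `A_c` (Jordan–Hölder: `N`
lies in the span of the irreducible images, gen 70 I2 `exists_iso_of_irreducible_le_iSup`; compose with
`ι_{c,j}`). [cite: Serre1977, §2.6] [cite: Lang2002, XVII §2] -/
theorem exists_class_iso_of_irreducible
    (hRst : ∀ c (k : G) (a : Yc c → ℚ), a ∈ Ar c → (fun y => a (k • y)) ∈ Ar c)
    (hRirr : ∀ c (W : Submodule ℚ (Yc c → ℚ)), W ≤ Ar c → W ≠ ⊥ →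
      (∀ (k : G) (f : Yc c → ℚ), f ∈ W → (fun y => f (k • y)) ∈ W) → W = Ar c)
    (ι : ∀ c, JJ c → ((Yc c → ℚ) →ₗ[ℚ] (Y₀ → ℚ)))
    (hιeq : ∀ c (j : JJ c) (k : G) (a : Yc c → ℚ), a ∈ Ar c →
      ι c j (fun y => a (k • y)) = fun y => ι c j a (k • y))
    (hinj : ∀ c (j : JJ c) (a : Yc c → ℚ), a ∈ Ar c → ι c j a = 0 → a = 0)
    (htop : (⨆ c, ⨆ j, (Ar c).map (ι c j)) = ⊤)
    [∀ q : (Σ c, JJ c), FiniteDimensional ℚ ↥((Ar q.1).map (ι q.1 q.2))]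
    {N : Submodule ℚ (Y₀ → ℚ)} [FiniteDimensional ℚ N]
    (hNst : ∀ (k : G) (f : Y₀ → ℚ), f ∈ N → (fun y => f (k • y)) ∈ N)
    (hNirr : ∀ W : Submodule ℚ (Y₀ → ℚ), W ≤ N → W ≠ ⊥ →
      (∀ (k : G) (f : Y₀ → ℚ), f ∈ W → (fun y => f (k • y)) ∈ W) → W = N)
    (hN0 : N ≠ ⊥) :
    ∃ (c : C) (θ : (Yc c → ℚ) →ₗ[ℚ] (Y₀ → ℚ)), (∀ a ∈ Ar c, θ a ∈ N) ∧ (∀ a ∈ Ar c, θ a = 0 → a = 0) ∧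
      (∀ v ∈ N, ∃ a ∈ Ar c, θ a = v) ∧
      ∀ (k : G) (a : Yc c → ℚ), a ∈ Ar c → θ (fun y => a (k • y)) = fun y => θ a (k • y) := by
  let T : G → (Y₀ → ℚ) →ₗ[ℚ] (Y₀ → ℚ) := fun k => LinearMap.funLeft ℚ ℚ fun y : Y₀ => k • y
  -- the images are stable irreducible and span
  have himg : ∀ q : (Σ c, JJ c),
      (∀ (k : G) (v : Y₀ → ℚ), v ∈ (Ar q.1).map (ι q.1 q.2) → (fun y => v (k • y)) ∈ (Ar q.1).map (ι q.1 q.2)) ∧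
      ∀ W : Submodule ℚ (Y₀ → ℚ), W ≤ (Ar q.1).map (ι q.1 q.2) → W ≠ ⊥ →
        (∀ (k : G) (f : Y₀ → ℚ), f ∈ W → (fun y => f (k • y)) ∈ W) → W = (Ar q.1).map (ι q.1 q.2) :=
    fun q => map_stable_irreducible_of_equivariant (G := G) (ι q.1 q.2) (hRst q.1) (hRirr q.1) (hιeq q.1 q.2)
  have hle : N ≤ ⨆ q : (Σ c, JJ c), (Ar q.1).map (ι q.1 q.2) := by
    rw [iSup_sigma, htop]
    exact le_top
  obtain ⟨q₀, -, P, hPN, hPinj, hPsurj, hPeq⟩ := exists_iso_of_irreducible_le_iSup T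
    (N := fun q : (Σ c, JJ c) => (Ar q.1).map (ι q.1 q.2)) (fun q k v hv => (himg q).1 k v hv)
    (fun q W hW hW0 hWst => (himg q).2 W hW hW0 fun k f hf => hWst k f hf) (M := N)
    (fun k f hf => hNst k f hf) (fun W hW hW0 hWst => hNirr W hW hW0 fun k f hf => hWst k f hf) hN0 hle
  refine ⟨q₀.1, P ∘ₗ ι q₀.1 q₀.2, fun a ha => hPN _ (Submodule.mem_map_of_mem ha),
    fun a ha h0 => hinj _ _ a ha (hPinj _ (Submodule.mem_map_of_mem ha) h0), fun v hv => ?_, fun k a ha => ?_⟩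
  · obtain ⟨w, hw, hPw⟩ := hPsurj v hv
    obtain ⟨a, ha, rfl⟩ := Submodule.mem_map.1 hw
    exact ⟨a, ha, hPw⟩
  · show P (ι q₀.1 q₀.2 (fun y => a (k • y))) = fun y => P (ι q₀.1 q₀.2 a) (k • y)
    rw [hιeq q₀.1 q₀.2 k a ha]
    exact hPeq k _ (Submodule.mem_map_of_mem ha)

/-! ### §3 Uniqueness: a constituent comes from only one reference -/

omit [Fintype Y₀] [Fintype C] [∀ c, Fintype (Yc c)] [∀ c, Fintype (JJ c)] in
/-- **UNIQUENESS OF THE CLASS.**  References pairwise non-embeddable (`hsep`); `θ` is injective and equivariant on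
`A_c` with `θ(A_c) ⊇ N`, and `θ′` EMBEDS `A_{c′}` equivariantly into `N`.  Then `c = c′`: transporting the
inclusion `θ′(A_{c′}) ⊆ N = θ(A_c)` back through `θ` (gen 75 M1 `exists_embed_of_map_embed`) embeds `A_{c′}` into
`A_c`. [cite: Serre1977, §2.2 and §2.6] [cite: Lang2002, XVII §1 Prop. 1.1] -/
theorem eq_of_embed_of_onto
    (hRst : ∀ c (k : G) (a : Yc c → ℚ), a ∈ Ar c → (fun y => a (k • y)) ∈ Ar c)
    (hR0 : ∀ c, Ar c ≠ ⊥)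
    (hsep : ∀ c c' (L : (Yc c → ℚ) →ₗ[ℚ] (Yc c' → ℚ)), c ≠ c' → Ar c ≠ ⊥ → (∀ a ∈ Ar c, L a ∈ Ar c') →
      (∀ a ∈ Ar c, L a = 0 → a = 0) →
      (∀ (k : G) (a : Yc c → ℚ), a ∈ Ar c → L (fun y => a (k • y)) = fun y => L a (k • y)) → False)
    {N : Submodule ℚ (Y₀ → ℚ)} {c c' : C}
    (θ : (Yc c → ℚ) →ₗ[ℚ] (Y₀ → ℚ)) (hθinj : ∀ a ∈ Ar c, θ a = 0 → a = 0)
    (hθsurj : ∀ v ∈ N, ∃ a ∈ Ar c, θ a = v)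
    (hθeq : ∀ (k : G) (a : Yc c → ℚ), a ∈ Ar c → θ (fun y => a (k • y)) = fun y => θ a (k • y))
    (θ' : (Yc c' → ℚ) →ₗ[ℚ] (Y₀ → ℚ)) (hθ'N : ∀ a ∈ Ar c', θ' a ∈ N) (hθ'inj : ∀ a ∈ Ar c', θ' a = 0 → a = 0)
    (hθ'eq : ∀ (k : G) (a : Yc c' → ℚ), a ∈ Ar c' → θ' (fun y => a (k • y)) = fun y => θ' a (k • y)) :
    c = c' := by
  by_contra hne
  -- transport: `θ′(A_{c′}) ⊆ N = θ(A_c)` gives an embedding `A_{c′} ↪ A_c`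
  have hL : ∀ v ∈ (Ar c').map θ', (LinearMap.id : (Y₀ → ℚ) →ₗ[ℚ] (Y₀ → ℚ)) v ∈ (Ar c).map θ := by
    intro v hv
    obtain ⟨a', ha', rfl⟩ := Submodule.mem_map.1 hv
    obtain ⟨a, ha, hθa⟩ := hθsurj _ (hθ'N a' ha')
    exact Submodule.mem_map.2 ⟨a, ha, hθa⟩
  obtain ⟨L', hL'N, hL'inj, hL'eq⟩ := exists_embed_of_map_embed (G := G) (hRst c') (hRst c) θ' θ hθ'eq hθeq
    hθ'inj hθinj LinearMap.id hL (fun v _ h => h) (fun _ _ _ => rfl)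
  exact hsep c' c L' (Ne.symm hne) (hR0 c') hL'N hL'inj hL'eq

end Abstract

/-! ### §4 Hodge equivalence with no input but the types -/

variable {I : Type u} {E : I → Type v} [∀ i, MulAction G (E i)] [∀ i, Fintype (E i)] [Fintype I]

/-- **HODGE EQUIVALENCE OF TWO MEMBERS DECIDED CLASS BY CLASS, WITH NO INPUT BUT THE TYPES.**  For ANY sets
`Φ_i ⊆ E_i` (`i ∈ I` finite) there is an isotypic decomposition of the type vectors `u_i = antiVec Φ_i 1` (references
`A_c` stable irreducible non-zero pairwise non-embeddable, commutants `𝒟_c`, equivariant jointly independent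
embeddings, components `b^i_{c,j} ∈ A_c`, `u_i = Σ ι(b)`) such that for EVERY two members `i₀, i₁`:
**`MC_{i₁} = MC_{i₀} ⟺ ∀ c, ⨆_j 𝒟_c·b^{i₁}_{c,j} = ⨆_j 𝒟_c·b^{i₀}_{c,j}`** (`MC_i = span{g ↦ u_i(g·x)} ≤ ℚ^G` the
character space of `MT(A_i)`; gen 75 M8 + E3). [cite: Deligne1982HodgeCycles, I.3.4 and I.5 (p. 53)]
[cite: Serre1977, §2.6] [cite: Gordon1999HodgeAVSurvey, 7.5–7.7] -/
theorem exists_isotypic_span_coeff_eq_iff (Φ : ∀ i, Set (E i)) :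
    ∃ (n : ℕ) (Ar : Fin n → Submodule ℚ ((Σ i, E i) → ℚ))
      (𝒟 : Fin n → Submodule ℚ (((Σ i, E i) → ℚ) →ₗ[ℚ] ((Σ i, E i) → ℚ))) (m : I → Fin n → ℕ)
      (ι : ∀ (i : I) (c : Fin n), Fin (m i c) → (((Σ i, E i) → ℚ) →ₗ[ℚ] (E i → ℚ)))
      (b : ∀ (i : I) (c : Fin n), Fin (m i c) → ((Σ i, E i) → ℚ)),
      (∀ (c : Fin n) (L : ((Σ i, E i) → ℚ) →ₗ[ℚ] ((Σ i, E i) → ℚ)), L ∈ 𝒟 c ↔ (∀ a ∈ Ar c, L a ∈ Ar c) ∧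
        ∀ (k : G) (a : (Σ i, E i) → ℚ), a ∈ Ar c → L (fun x => a (k • x)) = fun x => L a (k • x)) ∧
      (∀ (c : Fin n) (k : G) (a : (Σ i, E i) → ℚ), a ∈ Ar c → (fun x => a (k • x)) ∈ Ar c) ∧
      (∀ (c : Fin n) (W : Submodule ℚ ((Σ i, E i) → ℚ)), W ≤ Ar c → W ≠ ⊥ →
        (∀ (k : G) (f : (Σ i, E i) → ℚ), f ∈ W → (fun x => f (k • x)) ∈ W) → W = Ar c) ∧
      (∀ c : Fin n, Ar c ≠ ⊥) ∧
      (∀ (c c' : Fin n) (L : ((Σ i, E i) → ℚ) →ₗ[ℚ] ((Σ i, E i) → ℚ)), c ≠ c' → Ar c ≠ ⊥ →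
        (∀ a ∈ Ar c, L a ∈ Ar c') → (∀ a ∈ Ar c, L a = 0 → a = 0) →
        (∀ (k : G) (a : (Σ i, E i) → ℚ), a ∈ Ar c → L (fun x => a (k • x)) = fun x => L a (k • x)) →
        False) ∧
      (∀ (i : I) (c : Fin n) (j : Fin (m i c)) (k : G) (a : (Σ i, E i) → ℚ), a ∈ Ar c →
        ι i c j (fun x => a (k • x)) = fun s => ι i c j a (k • s)) ∧
      (∀ (i : I) (c : Fin n) (f : Fin (m i c) → ((Σ i, E i) → ℚ)), (∀ j, f j ∈ Ar c) →
        ∑ j, ι i c j (f j) = 0 → ∀ j, f j = 0) ∧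
      (∀ i c j, b i c j ∈ Ar c) ∧ (∀ i, antiVec (Φ i) (1 : G) = ∑ c, ∑ j, ι i c j (b i c j)) ∧
      ∀ i₀ i₁ : I,
        (Submodule.span ℚ (Set.range fun x : E i₁ => fun g : G => antiVec (Φ i₁) g x) =
            Submodule.span ℚ (Set.range fun x : E i₀ => fun g : G => antiVec (Φ i₀) g x) ↔
          ∀ c, (⨆ j, (𝒟 c).map (LinearMap.applyₗ (b i₁ c j))) =
            ⨆ j, (𝒟 c).map (LinearMap.applyₗ (b i₀ c j))) := by
  obtain ⟨n, Ar, 𝒟, m, ι, b, a₀, h𝒟, hRst, hRirr, hR0, hsep, hιeq, hind, hb, hu, -, -⟩ :=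
    exists_isotypic_decomposition_antiVec (G := G) Φ
  exact ⟨n, Ar, 𝒟, m, ι, b, h𝒟, hRst, hRirr, hR0, hsep, hιeq, hind, hb, hu, fun i₀ i₁ =>
    span_coeff_eq_iff_forall_iSup_eq_of_classes (Yc := fun _ : Fin n => Σ i, E i)
      (JJ := fun i c => Fin (m i c)) Φ i₀ i₁ h𝒟 hRst hRirr hR0 hsep ι hιeq hind hb hu⟩

variable [∀ i, Nonempty (E i)]

/-- **TWO-MEMBER FAMILIES: `rank Σ = rank Φ₀ = rank Φ₁ ⟺ ∀ c, ⨆_j 𝒟_c·b¹_{c,j} = ⨆_j 𝒟_c·b⁰_{c,j}` WITH NO INPUT BUT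
THE TYPES** (`I = {i₀, i₁}`; mutual Hodge domination of the two factors decided class by class over the commutants;
gen 75 M8 + E3). [cite: Deligne1982HodgeCycles, I.5 (p. 53)] [cite: Gordon1999HodgeAVSurvey, 7.5–7.7] -/
theorem exists_isotypic_typeRank_pair_eq_and_eq_iff {ρ : G} {Φ : ∀ i, Set (E i)}
    (h : ∀ i, IsCMTypeWith ρ (Φ i)) {i₀ i₁ : I} (hI : ∀ j, j = i₀ ∨ j = i₁) :
    ∃ (n : ℕ) (Ar : Fin n → Submodule ℚ ((Σ i, E i) → ℚ))
      (𝒟 : Fin n → Submodule ℚ (((Σ i, E i) → ℚ) →ₗ[ℚ] ((Σ i, E i) → ℚ))) (m : I → Fin n → ℕ)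
      (ι : ∀ (i : I) (c : Fin n), Fin (m i c) → (((Σ i, E i) → ℚ) →ₗ[ℚ] (E i → ℚ)))
      (b : ∀ (i : I) (c : Fin n), Fin (m i c) → ((Σ i, E i) → ℚ)),
      (∀ (c : Fin n) (L : ((Σ i, E i) → ℚ) →ₗ[ℚ] ((Σ i, E i) → ℚ)), L ∈ 𝒟 c ↔ (∀ a ∈ Ar c, L a ∈ Ar c) ∧
        ∀ (k : G) (a : (Σ i, E i) → ℚ), a ∈ Ar c → L (fun x => a (k • x)) = fun x => L a (k • x)) ∧
      (∀ (c : Fin n) (k : G) (a : (Σ i, E i) → ℚ), a ∈ Ar c → (fun x => a (k • x)) ∈ Ar c) ∧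
      (∀ (c : Fin n) (W : Submodule ℚ ((Σ i, E i) → ℚ)), W ≤ Ar c → W ≠ ⊥ →
        (∀ (k : G) (f : (Σ i, E i) → ℚ), f ∈ W → (fun x => f (k • x)) ∈ W) → W = Ar c) ∧
      (∀ c : Fin n, Ar c ≠ ⊥) ∧
      (∀ (c c' : Fin n) (L : ((Σ i, E i) → ℚ) →ₗ[ℚ] ((Σ i, E i) → ℚ)), c ≠ c' → Ar c ≠ ⊥ →
        (∀ a ∈ Ar c, L a ∈ Ar c') → (∀ a ∈ Ar c, L a = 0 → a = 0) →
        (∀ (k : G) (a : (Σ i, E i) → ℚ), a ∈ Ar c → L (fun x => a (k • x)) = fun x => L a (k • x)) →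
        False) ∧
      (∀ (i : I) (c : Fin n) (j : Fin (m i c)) (k : G) (a : (Σ i, E i) → ℚ), a ∈ Ar c →
        ι i c j (fun x => a (k • x)) = fun s => ι i c j a (k • s)) ∧
      (∀ (i : I) (c : Fin n) (f : Fin (m i c) → ((Σ i, E i) → ℚ)), (∀ j, f j ∈ Ar c) →
        ∑ j, ι i c j (f j) = 0 → ∀ j, f j = 0) ∧
      (∀ i c j, b i c j ∈ Ar c) ∧ (∀ i, antiVec (Φ i) (1 : G) = ∑ c, ∑ j, ι i c j (b i c j)) ∧
      ((typeRank G (sigmaType Φ) = typeRank G (Φ i₀) ∧ typeRank G (sigmaType Φ) = typeRank G (Φ i₁)) ↔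
        ∀ c, (⨆ j, (𝒟 c).map (LinearMap.applyₗ (b i₁ c j))) =
          ⨆ j, (𝒟 c).map (LinearMap.applyₗ (b i₀ c j))) := by
  obtain ⟨n, Ar, 𝒟, m, ι, b, a₀, h𝒟, hRst, hRirr, hR0, hsep, hιeq, hind, hb, hu, -, -⟩ :=
    exists_isotypic_decomposition_antiVec (G := G) Φ
  exact ⟨n, Ar, 𝒟, m, ι, b, h𝒟, hRst, hRirr, hR0, hsep, hιeq, hind, hb, hu,
    typeRank_pair_eq_and_eq_iff_forall_iSup_eq_of_classes (Yc := fun _ : Fin n => Σ i, E i)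
      (JJ := fun i c => Fin (m i c)) h hI h𝒟 hRst hRirr hR0 hsep ι hιeq hind hb hu⟩

end Summit.HodgeConjecture.CorCM.IrrOdd

/-! ### §5 Products of two CM abelian varieties -/

namespace Summit.HodgeConjecture.CorCM

open CategoryTheory CategoryTheory.Limits NumberField Module IntermediateField
open Literature.NumberTheory.ComplexMultiplication
open Literature.AlgebraicGeometry.Motives (AbelianVariety CMType)
open Literature.AlgebraicGeometry.Motives.AbelianVariety
open Literature.AlgebraicGeometry.HodgeTheory
open Literature.AlgebraicGeometry.ComplexMultiplication (IsCMTypeRealisation)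
open Literature.AlgebraicGeometry.Pohlmann1968

variable {I : Type} [Fintype I] {K : I → Type} [∀ i, Field (K i)] [∀ i, NumberField (K i)] [∀ i, IsCMField (K i)]

/-- **MUTUAL HODGE DOMINATION OF TWO CM ABELIAN VARIETIES DECIDED CLASS BY CLASS, WITH NO INPUT BUT THE CM TYPES**
(`I = {i₀, i₁}`): there is an isotypic decomposition of the type vectors for which **`dim MT(A₀ × A₁) = dim MT(A₀) =
dim MT(A₁) ⟺ ∀ c, ⨆_j 𝒟_c·b¹_{c,j} = ⨆_j 𝒟_c·b⁰_{c,j}`** (gen 75 M8-CM + E3). [cite: Deligne1982HodgeCycles, I.5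
(p. 53)] [cite: Gordon1999HodgeAVSurvey, 7.5–7.7] -/
theorem exists_isotypic_cmFamilyRank_pair_eq_and_eq_iff (Φ : ∀ i, CMType (K i)) {i₀ i₁ : I}
    (hI : ∀ j, j = i₀ ∨ j = i₁) :
    ∃ (n : ℕ) (Ar : Fin n → Submodule ℚ ((Σ i, (K i →+* ℂ)) → ℚ))
      (𝒟 : Fin n → Submodule ℚ (((Σ i, (K i →+* ℂ)) → ℚ) →ₗ[ℚ] ((Σ i, (K i →+* ℂ)) → ℚ)))
      (m : I → Fin n → ℕ)
      (ι : ∀ (i : I) (c : Fin n), Fin (m i c) → (((Σ i, (K i →+* ℂ)) → ℚ) →ₗ[ℚ] ((K i →+* ℂ) → ℚ)))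
      (b : ∀ (i : I) (c : Fin n), Fin (m i c) → ((Σ i, (K i →+* ℂ)) → ℚ)),
      (∀ (c : Fin n) (L : ((Σ i, (K i →+* ℂ)) → ℚ) →ₗ[ℚ] ((Σ i, (K i →+* ℂ)) → ℚ)), L ∈ 𝒟 c ↔
        (∀ a ∈ Ar c, L a ∈ Ar c) ∧ ∀ (k : ℂ ≃+* ℂ) (a : (Σ i, (K i →+* ℂ)) → ℚ), a ∈ Ar c →
          L (fun x => a (k • x)) = fun x => L a (k • x)) ∧
      (∀ (c : Fin n) (k : ℂ ≃+* ℂ) (a : (Σ i, (K i →+* ℂ)) → ℚ), a ∈ Ar c → (fun x => a (k • x)) ∈ Ar c) ∧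
      (∀ (c : Fin n) (W : Submodule ℚ ((Σ i, (K i →+* ℂ)) → ℚ)), W ≤ Ar c → W ≠ ⊥ →
        (∀ (k : ℂ ≃+* ℂ) (f : (Σ i, (K i →+* ℂ)) → ℚ), f ∈ W → (fun x => f (k • x)) ∈ W) → W = Ar c) ∧
      (∀ c : Fin n, Ar c ≠ ⊥) ∧
      (∀ (c c' : Fin n) (L : ((Σ i, (K i →+* ℂ)) → ℚ) →ₗ[ℚ] ((Σ i, (K i →+* ℂ)) → ℚ)), c ≠ c' → Ar c ≠ ⊥ →
        (∀ a ∈ Ar c, L a ∈ Ar c') → (∀ a ∈ Ar c, L a = 0 → a = 0) →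
        (∀ (k : ℂ ≃+* ℂ) (a : (Σ i, (K i →+* ℂ)) → ℚ), a ∈ Ar c →
          L (fun x => a (k • x)) = fun x => L a (k • x)) → False) ∧
      (∀ (i : I) (c : Fin n) (j : Fin (m i c)) (k : ℂ ≃+* ℂ) (a : (Σ i, (K i →+* ℂ)) → ℚ), a ∈ Ar c →
        ι i c j (fun x => a (k • x)) = fun s => ι i c j a (k • s)) ∧
      (∀ (i : I) (c : Fin n) (f : Fin (m i c) → ((Σ i, (K i →+* ℂ)) → ℚ)), (∀ j, f j ∈ Ar c) →
        ∑ j, ι i c j (f j) = 0 → ∀ j, f j = 0) ∧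
      (∀ i c j, b i c j ∈ Ar c) ∧
      (∀ i, antiVec (Φ i).1 (1 : ℂ ≃+* ℂ) = ∑ c, ∑ j, ι i c j (b i c j)) ∧
      ((CMAlgebra.cmFamilyRank Φ = cmTypeRank (Φ i₀) ∧ CMAlgebra.cmFamilyRank Φ = cmTypeRank (Φ i₁)) ↔
        ∀ c, (⨆ j, (𝒟 c).map (LinearMap.applyₗ (b i₁ c j))) =
          ⨆ j, (𝒟 c).map (LinearMap.applyₗ (b i₀ c j))) := by
  haveI : ∀ i, Nonempty (K i →+* ℂ) := fun i => inferInstance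
  exact IrrOdd.exists_isotypic_typeRank_pair_eq_and_eq_iff (G := ℂ ≃+* ℂ) (E := fun i => K i →+* ℂ)
    (Φ := fun i => (Φ i).1) (fun i => isCMTypeWith_conj (Φ i)) hI

end Summit.HodgeConjecture.CorCM

end
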